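import Summits.HubbardSuperconductivity.HubbardSuperconductivity.Theorems.AnisotropyChordTransferFibre3RowDAtoms
import Summits.HubbardSuperconductivity.HubbardSuperconductivity.Theorems.AnisotropyChordTransferFibre3SideCondCellT
import Summits.HubbardSuperconductivity.HubbardSuperconductivity.Theorems.AnisotropyChordTransferFibre3ManifoldA64
import Summits.HubbardSuperconductivity.HubbardSuperconductivity.Theorems.AnisotropyChordTransferFibre3RowDTAtoms
import Summits.HubbardSuperconductivity.HubbardSuperconductivity.Theorems.AnisotropyChordTransferFibre3BlockSoundR

/-!
# Route `AnisotropyChord` / H0 rotor rung, row D (KT-2a) on the t-BLOCKS with RING brackets: `…R` twins of `…RowDTAtoms`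

The theorems of `…RowDTAtoms` that take the block-cell certificate `(hc : c.check = true)`, restated VERBATIM for RING-checked cells
(`hc : c.checkR = true`, p2's `L2.TCell.checkR` of `…L2TCellR`; box bridge `L2.N1.pmem_xTrueTR` / `RowC.finalVec_mem_of_cellFinalBoxTR`
of `…BlockSoundR`), names suffixed `R`: .
Prover seat `hubbard-h0-rotor-p1` g32 (route lead; ASK 3 follow-up, p2 CLAIM 3 division «row-D/row-C cell-layer twins not by p2»);
helper for piece A = stmt-HubbardSuperconductivity-23918 of rung 19089 (`--supports`, helper class).  Nothing here proves superconductivity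
in the Hubbard model.  Mathlib + the tree only; no sorry.
-/

set_option linter.dupNamespace false
set_option autoImplicit false

noncomputable section

open scoped BigOperators
open Literature.Analysis.ValidatedNumerics

namespace Summit.HubbardSuperconductivity.HubbardSuperconductivity.Theorems.AnisotropyChord.Transfer.Fibre3

namespace RowD

namespace T

open RowC L2 L2.N1

variable (L : ℕ) [NeZero L]

variable (Δ lam2 : ℝ) (f : Tor L → ℝ)

/-- ★ MEMBERSHIP: for a ground profile located in the cell, if `rowDBox c a₁ a₂ pi = some B'` then the true row-D vector is a
prefix-member of `B'` and `B'.length = 125`. [folklore] -/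
theorem rowDBox_pmemR (c : L2.TCell) (a1 a2 : ℚ) (pi : ℕ × ℕ) {B' : Box}
    (hB' : rowDBox c a1 a2 pi = some B') (hc : c.checkR = true) (hL : 64 ≤ L) (hL0 : c.L0 ≤ L) (hL1 : c.L1 = 0 ∨ L ≤ c.L1)
    {Δ lam2 : ℝ} {f : Tor L → ℝ} (hΔ0 : 0 ≤ Δ) (hΔ1 : Δ < 1) (hf : IsGroundTwoMagnon L Δ lam2 f)
    (hν1 : (c.n1 : ℝ) / c.νd ≤ lam2 / (2 * Real.pi / L) ^ 2) (hν2 : lam2 / (2 * Real.pi / L) ^ 2 ≤ (c.n2 : ℝ) / c.νd)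
    (ha1 : ((a1 : ℚ) : ℝ) ≤ Δ * f (K1 L)) (ha2 : Δ * f (K1 L) ≤ ((a2 : ℚ) : ℝ)) :
    PMem B' (xTrueD L Δ lam2 f) ∧ B'.length = 125 := by
  classical
  set X := xTrue L Δ lam2 f (Δ * f (K1 L)) with hXdef
  have hLpos : (0 : ℝ) < L := by exact_mod_cast (show 0 < L by omega)
  have hπ := Real.pi_pos
  have ht0 : 0 < (2 * Real.pi / (L : ℝ)) ^ 2 := by positivity
  -- regime facts (as in `rowC_core`)
  have hlam : 0 < lam2 := lam2_pos L (by omega) hΔ1 hf.1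
  have h2 : 2 * lam2 < eps1 L := two_lam2_lt_eps1 L (by omega) hΔ0 hf
  obtain ⟨ha0, haV, _, _⟩ := ManifoldA.manifold_band64 L hL hΔ0 hΔ1 hf
  have hνc := ManifoldA.nu_ceiling64 L hL hΔ0 hf
  have hν4 : lam2 / (2 * Real.pi / L) ^ 2 < 4 / Real.pi ^ 2 := by
    rw [div_lt_iff₀ ht0]
    have hπ2 : Real.pi ^ 2 < 10 := by nlinarith [Real.pi_lt_d2, Real.pi_pos]
    have : (0.0359 : ℝ) ≤ 4 / Real.pi ^ 2 := by rw [le_div_iff₀ (by positivity)]; nlinarith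
    nlinarith
  have hV1 : (1 : ℝ) / (L : ℝ) ^ 2 = (2 * Real.pi / L) ^ 2 * (4 * Real.pi ^ 2)⁻¹ := by field_simp; ring
  have hu' : 0 < 1 - Δ * f (K1 L) + Δ * f (K1 L) * ((2 * Real.pi / L) ^ 2 * (4 * Real.pi ^ 2)⁻¹) := by
    rw [← hV1]; nlinarith
  -- p2's chain up to the intermediate box
  have hPM : PMem (c.box a1 a2) X := L2.N1.pmem_xTrueTR L c hc a1 a2 hL0 hL1 Δ lam2 f _ hν1 hν2 ha1 ha2
  have hsp := xTrue_specs_ground L Δ lam2 f (by omega) hΔ0 hΔ1 hf hlam h2 hν4 ha0 hu'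
  have hlen0 : (c.box a1 a2).length = 16 := by simp [L2.TCell.box_length]
  have hv := specsVarsOkC_two
  simp only [specsVarsOkC, Bool.and_eq_true] at hv
  obtain ⟨hv1, _⟩ := hv
  have hS : SpecsHold X (c.box a1 a2).length (specs 2) := by
    rw [hlen0]; exact specsHold_of X (specs 2) 16 hv1 hsp
  unfold rowDBox cellBoxB at hB'
  split at hB'
  · exact absurd hB' (by simp)
  · rename_i B hB
    obtain ⟨hPB, hlenB⟩ := extendBox_sound pi.1 pi.2 X (specs 2) _ B hB hPM hS
    have hlenB' : B.length = 121 := by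
      rw [hlenB, hlen0]; simp only [specs, List.length_append, List.length_cons, List.length_nil, List.length_map]; rfl
    -- the true row-D vector agrees with `X` on `B`
    have hPBD : PMem B (xTrueD L Δ lam2 f) := by
      intro i hi
      have e : xTrueD L Δ lam2 f i = X i := by
        unfold xTrueD; rw [if_pos (by rw [hlenB'] at hi; exact hi)]
      rw [e]; exact hPB i hi
    have hSD : SpecsHold (xTrueD L Δ lam2 f) B.length sSpecs := by
      rw [hlenB']; exact sSpecs_hold L (by omega) Δ lam2 f
    obtain ⟨hP', hl'⟩ := extendBox_sound pi.1 pi.2 (xTrueD L Δ lam2 f) sSpecs B B' hB' hPBD hSD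
    exact ⟨hP', by rw [hl', hlenB']; rfl⟩

end T

end RowD

end Summit.HubbardSuperconductivity.HubbardSuperconductivity.Theorems.AnisotropyChord.Transfer.Fibre3

end
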